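import Mathlib.ModelTheory.Algebra.Field.Basic
import Mathlib.ModelTheory.Algebra.Field.IsAlgClosed
import Mathlib.ModelTheory.Algebra.Ring.Basic
import Mathlib.ModelTheory.Definability
import Mathlib.ModelTheory.Complexity
import Mathlib.FieldTheory.IsRealClosed.Basic
import Mathlib.Analysis.Polynomial.Basic
import Mathlib.Topology.Algebra.Polynomial
import Mathlib.Analysis.Real.Sqrt
import Literature.ModelTheory.ExponentialFields.Languages
import Literature.ModelTheory.ExponentialFields.ModelTheoryPreds
import Literature.ModelTheory.ExponentialFields.Semialgebraic
import HarnessLib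

-- provenance: harness21/H21/H21/Prelude/TranscendEllArithS/RealClosedFieldTheory.lean @ 2e50299 (interim HEAD d8f2665); M5 mechanical rewrite
/-!
# The first-order theory of real closed fields

Trunk `TranscendEllArithS`, concept C8 (`rcf_theory_sentences`).

We axiomatize ordered fields and real closed fields as first-order theories in the language of
ordered rings `Literature.Language.orderedRing = (+, *, -, 0, 1, ≤)` of C5, and relate their models to
Mathlib's algebraic classes `Field`/`IsStrictOrderedRing`/`IsRealClosed`:

* `Literature.ModelTheory.ExponentialFields.Theory.orderedField` : the field axioms (Mathlib's `Language.Theory.field`, transported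
  along `Literature.ModelTheory.ExponentialFields.ringHomOrderedRing`), the axioms of linear orders (Mathlib's
  `Language.linearOrderTheory`) and the two compatibility axioms `addMonotoneSentence`
  (`x ≤ y → z + x ≤ z + y`) and `mulPosSentence` (`0 ≤ x → 0 ≤ y → 0 ≤ x * y`);
* `Literature.oddDegreeHasRootSentence n` : every monic polynomial of degree `2 n + 1` has a root — this
  is Mathlib's `FirstOrder.Field.genericMonicPolyHasRoot (2 * n + 1)` transported to
  `Language.orderedRing`;
* `Literature.ModelTheory.ExponentialFields.nonnegHasSqrtSentence` : every nonnegative element is a square;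
* `Literature.ModelTheory.ExponentialFields.Theory.RCF` : the theory of real closed (ordered) fields (Tarski 1951; Marker §3.3).

API: models of `Theory.orderedField`/`Theory.RCF` among linearly ordered fields
(`model_orderedField`, `model_RCF_of_isRealClosed`, `isRealClosed_of_model_RCF`), the real field
is real closed (`isRealClosed_real`, proved from `Real.sqrt` and the intermediate value theorem)
and a model of `RCF` (`real_model_RCF`), and the link between `ℚ`-semialgebraic subsets of `ℝⁿ`
(C1, `Literature.ModelTheory.ExponentialFields.IsSemialgebraic`) and `Language.orderedRing`-definable sets with rational parameters
(`isSemialgebraic_iff_definable_qf`, and Tarski–Seidenberg in the form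
`definable_iff_isSemialgebraic_real`).

## Mathlib search

Mathlib has `Language.Theory.field` (a `Language.ring`-theory) with the instance
`[Field K] [CompatibleRing K] → Theory.field.Model K`, `FirstOrder.Field.genericMonicPolyHasRoot`
and `realize_genericMonicPolyHasRoot` (`ModelTheory/Algebra/Field/IsAlgClosed.lean`),
`Language.linearOrderTheory` with `model_linearOrder`, `LHom.onTheory`/`LHom.onTheory_model`,
`Set.Definable`, `BoundedFormula.IsQF`, and the class `IsRealClosed` with
`IsRealClosed.of_linearOrderedField`. It has no first-order theory of ordered or real closed
fields and no `IsRealClosed ℝ` instance (we grep'd `IsRealClosed ℝ`: absent).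

## Design choices

* As in C5 we write `open FirstOrder` only; `Language.ring`, `Language.Theory.field` are Mathlib's,
  `Language.orderedRing` is `Literature`'s.
* Following Mathlib's ACF file, statements about a concrete ordered field `R` that mention the
  `Language.ring`-theory `Theory.field` (through `ringHomOrderedRing.onTheory`) assume
  `[FirstOrder.Ring.CompatibleRing R]`; the `Language.orderedRing`-structure itself is the global
  instance of C5. For `ℝ` one uses `letI := FirstOrder.Ring.compatibleRingOfRing ℝ` in proofs.
* `mulPosSentence` is stated with `≤` (`0 ≤ x → 0 ≤ y → 0 ≤ x y`); over a field this is equivalent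
  to the strict version `0 < x → 0 < y → 0 < x y` (Bochnak–Coste–Roy §1.1).
* `isRealClosed_real` is a `theorem` (fully proved), not an instance, to avoid introducing a global
  instance that Mathlib may later add itself.

## References

* A. Tarski, *A decision method for elementary algebra and geometry*, 2nd ed., 1951.
* J. Bochnak, M. Coste, M.-F. Roy, *Real Algebraic Geometry*, Springer 1998, §1–2.
* D. Marker, *Model Theory: An Introduction*, Springer 2002, §3.3.
-/

noncomputable section

open FirstOrder Set

namespace Literature.ModelTheory.ExponentialFields

/-! ### The sentences and theories -/

/-- Translation invariance of the order, as a sentence of `Language.orderedRing`: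
`∀ x y z, x ≤ y → z + x ≤ z + y` (Bochnak–Coste–Roy 1998, Def. 1.1.1; Marker 2002, §3.3). [cite: BochnakCosteRoy1998, Def. 1.1.1] -/
def addMonotoneSentence : Language.orderedRing.Sentence :=
  ∀' ∀' ∀' ((&0).le &1 ⟹ Language.Term.le (&2 + &0) (&2 + &1))

/-- Compatibility of the order with multiplication, as a sentence of `Language.orderedRing`:
`∀ x y, 0 ≤ x → 0 ≤ y → 0 ≤ x * y` (Bochnak–Coste–Roy 1998, Def. 1.1.1; Marker 2002, §3.3). [cite: BochnakCosteRoy1998, Def. 1.1.1] -/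
def mulPosSentence : Language.orderedRing.Sentence :=
  ∀' ∀' ((0 : Language.orderedRing.Term _).le &0 ⟹
    ((0 : Language.orderedRing.Term _).le &1 ⟹ (0 : Language.orderedRing.Term _).le (&0 * &1)))

/-- The theory of ordered fields in the language `(+, *, -, 0, 1, ≤)`: Mathlib's field axioms
`Language.Theory.field` transported along `ringHomOrderedRing`, Mathlib's axioms of linear orders
`Language.linearOrderTheory`, and the compatibility axioms `addMonotoneSentence`,
`mulPosSentence` (Bochnak–Coste–Roy 1998, Def. 1.1.1; Marker 2002, Example 1.2.8 and §3.3). [cite: BochnakCosteRoy1998, Def. 1.1.1] -/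
def Theory.orderedField : Language.orderedRing.Theory :=
  ringHomOrderedRing.onTheory Language.Theory.field ∪ Language.orderedRing.linearOrderTheory ∪
    {addMonotoneSentence, mulPosSentence}

/-- The sentence "every monic polynomial of degree `2 n + 1` has a root", in the language of
ordered rings: Mathlib's `FirstOrder.Field.genericMonicPolyHasRoot (2 * n + 1)` transported along
`ringHomOrderedRing` (Tarski 1951; Marker 2002, §3.3). [cite: Tarski1951] -/
def oddDegreeHasRootSentence (n : ℕ) : Language.orderedRing.Sentence :=
  ringHomOrderedRing.onSentence (Field.genericMonicPolyHasRoot (2 * n + 1))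

/-- The sentence "every nonnegative element has a square root", `∀ x, 0 ≤ x → ∃ y, y * y = x`,
in the language of ordered rings (Tarski 1951; Marker 2002, §3.3). [cite: Tarski1951] -/
def nonnegHasSqrtSentence : Language.orderedRing.Sentence :=
  ∀' ((0 : Language.orderedRing.Term _).le &0 ⟹ ∃' ((&1 * &1) =' &0))

/-- The theory `RCF` of real closed fields in the language `(+, *, -, 0, 1, ≤)`: ordered fields in
which every nonnegative element is a square and every polynomial of odd degree has a root
(Tarski 1951; Bochnak–Coste–Roy 1998, Thm. 1.2.2; Marker 2002, §3.3). [cite: Tarski1951] -/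
def Theory.RCF : Language.orderedRing.Theory :=
  Theory.orderedField ∪ range oddDegreeHasRootSentence ∪ {nonnegHasSqrtSentence}

/-- `Theory.orderedField ⊆ Theory.RCF`. [folklore] -/
theorem Theory.orderedField_subset_RCF : Theory.orderedField ⊆ Theory.RCF :=
  subset_union_left.trans subset_union_left

/-! ### Realization of the sentences -/

section Realize

variable {R : Type*} [Add R] [Mul R] [Neg R] [Zero R] [One R] [LE R]

/-- Semantics of `addMonotoneSentence`. [folklore] -/
@[simp] theorem realize_addMonotoneSentence :
    R ⊨ addMonotoneSentence ↔ ∀ x y z : R, x ≤ y → z + x ≤ z + y := by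
  simp [addMonotoneSentence, Language.Sentence.Realize, Language.Formula.Realize, Fin.snoc]

/-- Semantics of `mulPosSentence`. [folklore] -/
@[simp] theorem realize_mulPosSentence :
    R ⊨ mulPosSentence ↔ ∀ x y : R, 0 ≤ x → 0 ≤ y → 0 ≤ x * y := by
  simp [mulPosSentence, Language.Sentence.Realize, Language.Formula.Realize, Fin.snoc]

/-- Semantics of `nonnegHasSqrtSentence`. [folklore] -/
@[simp] theorem realize_nonnegHasSqrtSentence :
    R ⊨ nonnegHasSqrtSentence ↔ ∀ x : R, 0 ≤ x → ∃ y, y * y = x := by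
  simp [nonnegHasSqrtSentence, Language.Sentence.Realize, Language.Formula.Realize, Fin.snoc]

end Realize

/-! ### Models -/

section Models

variable (R : Type*) [Field R] [LinearOrder R] [Ring.CompatibleRing R]

/-- Semantics of `oddDegreeHasRootSentence n` in a field: every monic polynomial of degree
`2 n + 1` has a root (from Mathlib's `realize_genericMonicPolyHasRoot`). [folklore] -/
theorem realize_oddDegreeHasRootSentence (n : ℕ) :
    R ⊨ oddDegreeHasRootSentence n ↔
      ∀ p : {p : Polynomial R // p.Monic ∧ p.natDegree = 2 * n + 1}, ∃ x, p.1.eval x = 0 := by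
  rw [oddDegreeHasRootSentence, Language.LHom.realize_onSentence,
    Field.realize_genericMonicPolyHasRoot]

/-- In a field, all the sentences `oddDegreeHasRootSentence n` hold iff every polynomial of odd
degree has a root (Marker 2002, §3.3). [cite: Marker2002, §3.3] -/
theorem forall_realize_oddDegreeHasRootSentence_iff :
    (∀ n, R ⊨ oddDegreeHasRootSentence n) ↔
      ∀ f : Polynomial R, Odd f.natDegree → ∃ x, f.IsRoot x := by
  simp only [realize_oddDegreeHasRootSentence, Subtype.forall, and_imp]
  constructor
  · rintro h f ⟨k, hk⟩
    have hf : f ≠ 0 := by rintro rfl; simp at hk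
    obtain ⟨x, hx⟩ := h k (f * Polynomial.C f.leadingCoeff⁻¹)
      (Polynomial.monic_mul_leadingCoeff_inv hf)
      (by rw [Polynomial.natDegree_mul_leadingCoeff_inv _ hf, hk])
    refine ⟨x, ?_⟩
    simpa [Polynomial.IsRoot, Polynomial.eval_mul, hf] using hx
  · intro h n f _ hn
    exact h f ⟨n, hn⟩

variable [IsStrictOrderedRing R]

/-- A linearly ordered field is a model of the theory of ordered fields
(Bochnak–Coste–Roy 1998, Def. 1.1.1). [cite: BochnakCosteRoy1998, Def. 1.1.1] -/
theorem model_orderedField : R ⊨ Theory.orderedField := by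
  refine Language.Theory.Model.union (Language.Theory.Model.union ?_ inferInstance) ?_
  · exact (Language.LHom.onTheory_model _ _).2 inferInstance
  · simp only [Language.Theory.model_insert_iff, Language.Theory.model_singleton_iff,
      realize_addMonotoneSentence, realize_mulPosSentence]
    exact ⟨fun x y z h => by gcongr, fun x y hx hy => mul_nonneg hx hy⟩

/-- A real closed field (with its order) is a model of `RCF` (Tarski 1951; Marker 2002, §3.3). [cite: Tarski1951] -/
theorem model_RCF_of_isRealClosed [IsRealClosed R] : R ⊨ Theory.RCF := by
  refine Language.Theory.Model.union (Language.Theory.Model.union (model_orderedField R) ?_) ?_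
  · refine ⟨?_⟩
    rintro _ ⟨n, rfl⟩
    exact (forall_realize_oddDegreeHasRootSentence_iff R).2
      (fun f hf => IsRealClosed.exists_isRoot_of_odd_natDegree hf) n
  · simp only [Language.Theory.model_singleton_iff, realize_nonnegHasSqrtSentence]
    intro x hx
    obtain ⟨y, hy⟩ := IsSquare.of_nonneg hx
    exact ⟨y, hy.symm⟩

/-- A linearly ordered field which is a model of `RCF` is real closed in Mathlib's sense
`IsRealClosed` (Tarski 1951; Marker 2002, Thm. 3.3.7). [cite: Tarski1951] -/
theorem isRealClosed_of_model_RCF [h : R ⊨ Theory.RCF] : IsRealClosed R := by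
  refine IsRealClosed.of_linearOrderedField (fun {x} hx => ?_) (fun {f} hf => ?_)
  · have hs : R ⊨ nonnegHasSqrtSentence :=
      Language.Theory.realize_sentence_of_mem Theory.RCF (by simp [Theory.RCF])
    obtain ⟨y, hy⟩ := realize_nonnegHasSqrtSentence.1 hs x hx
    exact ⟨y, hy.symm⟩
  · refine (forall_realize_oddDegreeHasRootSentence_iff R).1 (fun n => ?_) f hf
    exact Language.Theory.realize_sentence_of_mem Theory.RCF
      (mem_union_left _ (mem_union_right _ (mem_range_self n)))

/-- For a linearly ordered field, being a model of `RCF` is equivalent to `IsRealClosed`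
(Tarski 1951; Marker 2002, §3.3). [cite: Tarski1951] -/
theorem model_RCF_iff_isRealClosed : R ⊨ Theory.RCF ↔ IsRealClosed R :=
  ⟨fun _ => isRealClosed_of_model_RCF R, fun _ => model_RCF_of_isRealClosed R⟩

end Models

/-! ### The real numbers -/

/-- Every real polynomial of odd degree has a real root (intermediate value theorem);
Bochnak–Coste–Roy 1998, Ex. 1.2.3. [cite: BochnakCosteRoy1998, Ex. 1.2.3] -/
theorem Real.exists_isRoot_of_odd_natDegree {f : Polynomial ℝ} (hf : Odd f.natDegree) :
    ∃ x, f.IsRoot x := by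
  have hdeg : 0 < f.degree := by
    rw [Polynomial.degree_eq_natDegree]
    · exact_mod_cast hf.pos
    · rintro rfl
      simp at hf
  have hdeg' : 0 < (f.comp (-Polynomial.X)).degree := by simpa using hdeg
  have hlc : (f.comp (-Polynomial.X)).leadingCoeff = -f.leadingCoeff := by
    rw [Polynomial.comp_neg_X_leadingCoeff_eq, hf.neg_one_pow, neg_one_mul]
  suffices h : (∃ a, f.eval a ≤ 0) ∧ ∃ b, 0 ≤ f.eval b by
    obtain ⟨x, hx⟩ := mem_range_of_exists_le_of_exists_ge f.continuous h.1 h.2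
    exact ⟨x, hx⟩
  rcases le_total 0 f.leadingCoeff with hpos | hneg
  · have h₁ := f.tendsto_atTop_of_leadingCoeff_nonneg hdeg hpos
    have h₂ := (f.comp (-Polynomial.X)).tendsto_atBot_of_leadingCoeff_nonpos hdeg'
      (by rw [hlc]; exact neg_nonpos.2 hpos)
    obtain ⟨a, ha⟩ := (h₂.eventually (Filter.eventually_le_atBot 0)).exists
    obtain ⟨b, hb⟩ := (h₁.eventually (Filter.eventually_ge_atTop 0)).exists
    exact ⟨⟨-a, by simpa using ha⟩, b, hb⟩
  · have h₁ := f.tendsto_atBot_of_leadingCoeff_nonpos hdeg hneg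
    have h₂ := (f.comp (-Polynomial.X)).tendsto_atTop_of_leadingCoeff_nonneg hdeg'
      (by rw [hlc]; exact neg_nonneg.2 hneg)
    obtain ⟨a, ha⟩ := (h₁.eventually (Filter.eventually_le_atBot 0)).exists
    obtain ⟨b, hb⟩ := (h₂.eventually (Filter.eventually_ge_atTop 0)).exists
    exact ⟨⟨a, ha⟩, -b, by simpa using hb⟩

/-- The field of real numbers is real closed (Bochnak–Coste–Roy 1998, Ex. 1.2.3): nonnegative
reals have square roots (`Real.sqrt`) and odd-degree real polynomials have roots
(`Real.exists_isRoot_of_odd_natDegree`). Stated as a theorem, not an instance (Mathlib has no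
`IsRealClosed ℝ` instance at the pinned commit). [cite: BochnakCosteRoy1998, Ex. 1.2.3] -/
theorem isRealClosed_real : IsRealClosed ℝ :=
  IsRealClosed.of_linearOrderedField
    (fun {x} hx => ⟨Real.sqrt x, (Real.mul_self_sqrt hx).symm⟩)
    (fun {_} hf => Real.exists_isRoot_of_odd_natDegree hf)

/-- The ordered field `ℝ` is a model of `RCF` (Tarski 1951; Marker 2002, §3.3). [cite: Tarski1951] -/
theorem real_model_RCF : ℝ ⊨ Theory.RCF := by
  letI := Ring.compatibleRingOfRing ℝ
  haveI := isRealClosed_real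
  exact model_RCF_of_isRealClosed ℝ

/-- `Theory.RCF` is contained in the complete theory of the real ordered field
(`Literature.ModelTheory.ExponentialFields.realOrderedFieldTheory` of C5); Tarski 1951. [cite: Tarski1951] -/
theorem RCF_subset_realOrderedFieldTheory : Theory.RCF ⊆ realOrderedFieldTheory :=
  Language.Theory.model_iff_subset_completeTheory.1 real_model_RCF

/-! ### Semialgebraic versus definable sets -/

/-- `ℚ`-semialgebraic subsets of `ℝⁿ` (C1, `Literature.IsSemialgebraic ℚ`) are exactly the subsets
defined by a *quantifier-free* `Language.orderedRing`-formula with rational parameters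
(Bochnak–Coste–Roy 1998, Def. 2.1.4 and Prop. 2.1.8; Marker 2002, §3.3). [cite: BochnakCosteRoy1998, Def. 2.1.4 and Prop. 2.1.8] -/
def isSemialgebraic_iff_definable_qf : Prop :=
  ∀ {n : ℕ} (s : Set (Fin n → ℝ)),
    IsSemialgebraic ℚ s ↔
      ∃ φ : (Language.orderedRing[[range ((↑) : ℚ → ℝ)]]).Formula (Fin n),
        φ.IsQF ∧ s = setOf φ.Realize

/-- **Tarski–Seidenberg** (definable = semialgebraic): a subset of `ℝⁿ` is definable in the
ordered field `ℝ` with rational parameters if and only if it is `ℚ`-semialgebraic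
(Tarski 1951; Bochnak–Coste–Roy 1998, Prop. 2.2.4 and Thm. 2.2.1; Marker 2002, Cor. 3.3.16). [cite: Tarski1951] -/
def definable_iff_isSemialgebraic_real : Prop :=
  ∀ {n : ℕ} (s : Set (Fin n → ℝ)),
    (range ((↑) : ℚ → ℝ)).Definable Language.orderedRing s ↔ IsSemialgebraic ℚ s

end Literature.ModelTheory.ExponentialFields
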